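import Mathlib
import HarnessLib
import Literature.MathematicalPhysics.StatisticalMechanics.StepOperatorBLipschitzTorusFRD
import Literature.MathematicalPhysics.StatisticalMechanics.TuningLipschitzPackaging
import Literature.MathematicalPhysics.StatisticalMechanics.NextHamiltonianKernelSubTorusFRD
import Literature.MathematicalPhysics.StatisticalMechanics.StepOperatorALipschitz
import Literature.MathematicalPhysics.StatisticalMechanics.RGStepABKMQ

/-!
# Hypotheses (12.51)–(12.52) of [ABKM19] Lemma 12.6 for the torus steps, GLOBALLY on the ball of
# tuning parameters: `‖(A^{q'}_k)⁻¹ − (A^q_k)⁻¹‖ ≤ a_T Σ|q'−q|`, `‖B^{q'}_k v − B^q_k v‖ ≤ b_T Σ|q'−q| ‖v‖_k`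

For ONE finite-range-decomposition package `𝒞_{A,k}` (clauses (o)–(v) of `GradientFRD.TorusFRD d` for
every `A ∈ 𝓛(½,2)`), the weight tower of Theorem 7.1 built from `𝒞_{1,k}` (`AbkmWeightBounds`) and the
step-kernel families `𝒞s_q = (j ↦ 𝒞_{1+q,j})` of symmetric tuning parameters `q` in the ball
`Σ_{ij}|q_{ij}| ≤ T₀` (`T₀ ≤ ½`, `K T₀ ≤ log(1+ρ)`, `ρ < θ̄`, `K = shellRatioConst`), this file turns
the kernel-level comparison estimates of the tree into the two Lipschitz hypotheses of the fine-tuning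
engine `RGFlow.exists_isTunedQ_initial_eq_of_parametrised` at the level of the tuning parameter, with the
"distance" `Σ_{ij}|(q'−q)_{ij}|`:

* **`norm_rgA_symm_one_add_sub_le_of_torusFRD`** — `(12.51)` for `A_k = rgA L h 𝒞s_q k`:
  `‖(A^{q'}_k)⁻¹ w − (A^q_k)⁻¹ w‖ ≤ ((secondDiffConst(C_{·,1}) + 1)/(4h²)) · Σ|q'−q| · ‖w‖`
  (`StepOperatorALipschitz.norm_rgA_symm_sub_le` ∘ `abs_gradCov_one_add_sub_le_of_torusFRD`);
* **`stepKernelBounds_family_of_torusFRD`** — the `StepKernelBounds` family of `𝒞s_q` below the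
  horizon (the argument `hS` of `rgBQ`, `rgSQ`, `isRGStepQ_abkm_of_stepKernelBounds`);
* **`exists_norm_rgBQ_sub_le_of_torusFRD`** — `(12.52)` for `B_k = rgBQ`: there is `b_T ≥ 0`
  (depending on the package, the volume and the norm parameters, not on `k`, `q`, `q'`, `v`) with
  `‖B^{q'}_k v − B^q_k v‖ ≤ b_T · Σ|q'−q| · c` whenever `‖v‖_k ≤ c` (`activityNormLE`), `k + 1 ≤ N`:
  locally (`Σ|q'−q| ≤ T₁`) by `hamNorm_opB_sub_of_torusFRD` with `τ = e^{K Σ|q'−q|} − 1`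
  (`TuningLipschitzPackaging.exp_mul_sub_one_mul_le`), in the far field by Lemma 10.6
  (`hamNorm_opB_abkm_le_of_stepKernelBounds`) and `le_max_mul_of_local_lipschitz`.

Everything is proved; no named fact.  Not here: `(12.53)` for `S_k` (the two-kernel twin of the
Lipschitz chain) and the assembly of Lemma 12.6.

## References
* S. Adams, S. Buchholz, R. Kotecký, S. Müller, arXiv:1910.13564, Lemma 12.6 (12.51)–(12.52),
  Lemma 10.5, Lemma 10.6, Lemma 8.4 [AdamsBuchholzKoteckyMuller2019].
* S. Buchholz, J. Funct. Anal. 275 (2018), Thm 2.4 [Buchholz2016].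
-/

noncomputable section

namespace Literature.MathematicalPhysics.StatisticalMechanics.GradientRG

open scoped BigOperators
open Real Set Finset MeasureTheory
open Literature.MathematicalPhysics.StatisticalMechanics.GradientFRD
  (fourierCoeff cExt cExt_of_mem IsElliptic IsUnitSymm InShell iterDiff supNorm conv ellOp isElliptic_one)
open Literature.MathematicalPhysics.StatisticalMechanics.TorusPolymer (IsPolymer numBlocks blockOf boxCorner)
open Literature.Barriers.CriticalPhenomena.LongRangePhi4.Polymer (IsConn)
open Literature.MathematicalPhysics.QuantumFieldTheory
open Literature.Dynamics.Hyperbolic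

variable {d M : ℕ} [NeZero M]

/-- The entry sum `Σ_{ij}|m_{ij}|` is nonnegative. [cite: AdamsBuchholzKoteckyMuller2019, Lemma 12.6] -/
theorem entrySum_nonneg (m : Matrix (Fin d) (Fin d) ℝ) : 0 ≤ ∑ i, ∑ j, |m i j| :=
  sum_nonneg fun _ _ => sum_nonneg fun _ _ => abs_nonneg _

/-- `Σ_{ij}|m_{ij}| = 0` forces `m = 0`. [cite: AdamsBuchholzKoteckyMuller2019, Lemma 12.6] -/
theorem eq_zero_of_entrySum_eq_zero {m : Matrix (Fin d) (Fin d) ℝ} (h : ∑ i, ∑ j, |m i j| = 0) : m = 0 := by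
  ext i j
  have hle : |m i j| ≤ ∑ i, ∑ j, |m i j| :=
    (single_le_sum (f := fun j => |m i j|) (fun _ _ => abs_nonneg _) (mem_univ j)).trans
      (single_le_sum (f := fun i => ∑ j, |m i j|) (fun _ _ => sum_nonneg fun _ _ => abs_nonneg _)
        (mem_univ i))
  have : |m i j| = 0 := le_antisymm (h ▸ hle) (abs_nonneg _)
  simpa using this

/-! ## `(12.51)`: the inverse of `A_k` is Lipschitz in the tuning parameter -/

/-- **`(12.51)` at the level of the tuning parameter**: for one `TorusFRD` package (clause (iv)),
symmetric `q, q'` with `Σ|q_{ij}|, Σ|q'_{ij}| ≤ ½`, `k + 1 ≤ N + 1`,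
`‖(rgA L h 𝒞s_{q'} k)⁻¹ w − (rgA L h 𝒞s_q k)⁻¹ w‖ ≤ ((secondDiffConst(C_{·,1}) + 1)/(4h²))·Σ|q'−q|·‖w‖`.
[cite: AdamsBuchholzKoteckyMuller2019, Lemma 12.6 (12.51)] -/
theorem norm_rgA_symm_one_add_sub_le_of_torusFRD {L N n : ℕ} {h : ℝ} [Fact (0 < h)] [Fact (0 < L)]
    {𝒞 : Matrix (Fin d) (Fin d) ℝ → ℕ → (Fin d → ZMod M) → ℝ} {Cα : (Fin d → ℕ) → ℕ → ℝ}
    (hiv : ∀ A : Matrix (Fin d) (Fin d) ℝ, IsElliptic (1 / 2 : ℝ) 2 A →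
      ∀ k, 1 ≤ k → k ≤ N + 1 → ∀ B : Matrix (Fin d) (Fin d) ℝ, IsUnitSymm B →
        (∃ ε : ℝ, 0 < ε ∧ ∀ x : Fin d → ZMod M,
          ContDiffOn ℝ ⊤ (fun s : ℝ => 𝒞 (A + s • B) k x) (Set.Ioo (-ε) ε)) ∧
        ∀ α : Fin d → ℕ, ∑ i, α i ≤ n → ∀ ℓ : ℕ, ∀ x : Fin d → ZMod M,
          abs (iteratedDeriv ℓ (fun s : ℝ => iterDiff α (𝒞 (A + s • B) k) x) 0)
            ≤ Cα α ℓ / (L : ℝ) ^ ((k - 1) * (d - 2 + ∑ i, α i)))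
    (hd : 2 ≤ d) (hn : 2 ≤ n)
    {q q' : Matrix (Fin d) (Fin d) ℝ} (hq : q.IsSymm) (hq' : q'.IsSymm)
    (hq2 : ∑ i, ∑ j, |q i j| ≤ 1 / 2) (hq'2 : ∑ i, ∑ j, |q' i j| ≤ 1 / 2)
    {k : ℕ} (hkN : k + 1 ≤ N + 1)
    (w : HamSpace ℂ d (fieldWt h (L : ℝ) d (k + 1)) ((L : ℝ) ^ (k + 1)) (L ^ (d * (k + 1)))) :
    ‖(rgA L h (fun j => 𝒞 ((1 : Matrix (Fin d) (Fin d) ℝ) + q') j) k).symm w -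
        (rgA L h (fun j => 𝒞 ((1 : Matrix (Fin d) (Fin d) ℝ) + q) j) k).symm w‖ ≤
      (secondDiffConst (fun α => Cα α 1) + 1) / (4 * h ^ 2) * (∑ i, ∑ j, |(q' - q) i j|) * ‖w‖ := by
  have hh : 0 < h := Fact.out
  have hL : 0 < L := Fact.out
  set T := ∑ i, ∑ j, |(q' - q) i j| with hTdef
  have hT0 : 0 ≤ T := entrySum_nonneg _
  have hS0 : 0 ≤ secondDiffConst (fun α => Cα α 1) := secondDiffConst_nonneg _
  rcases hT0.eq_or_lt with hT | hT
  · -- `q' = q`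
    have hqq : q' = q := sub_eq_zero.1 (eq_zero_of_entrySum_eq_zero hT.symm)
    rw [hqq, sub_self, norm_zero, ← hT, mul_zero, zero_mul]
  · -- `δ = (S+1)·T > 0`
    have hδ : 0 < (secondDiffConst (fun α => Cα α 1) + 1) * T := mul_pos (by linarith) hT
    have hγ : ∀ p : quadIndex d, ((L ^ (d * k) : ℕ) : ℝ) *
        |gradCov (𝒞 ((1 : Matrix (Fin d) (Fin d) ℝ) + q') (k + 1)) p -
          gradCov (𝒞 ((1 : Matrix (Fin d) (Fin d) ℝ) + q) (k + 1)) p| ≤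
        (secondDiffConst (fun α => Cα α 1) + 1) * T := by
      intro p
      refine (abs_gradCov_one_add_sub_le_of_torusFRD hiv hd hn hL hq hq' hq2 hq'2 hkN p).trans ?_
      exact mul_le_mul_of_nonneg_right (by linarith) hT0
    have h1 := norm_rgA_symm_sub_le (h := h) (𝒞s := fun j => 𝒞 ((1 : Matrix (Fin d) (Fin d) ℝ) + q') j)
      (𝒞s' := fun j => 𝒞 ((1 : Matrix (Fin d) (Fin d) ℝ) + q) j) hd hδ k hγ w
    refine h1.trans (le_of_eq ?_)
    field_simp

/-! ## The `StepKernelBounds` family of `𝒞s_q` below the horizon -/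

section Package

variable {L N Mord R n ñ : ℕ} {θbar lam μ δ₁ δ₀ A𝒫 : ℝ}
    {𝒞 : Matrix (Fin d) (Fin d) ℝ → ℕ → (Fin d → ZMod M) → ℝ} {Mc : ℕ → ℝ}
    {Cα : (Fin d → ℕ) → ℕ → ℝ} {c C : ℝ} {Cℓ : ℕ → ℝ}

/-- **The `StepKernelBounds` family of the step kernels `𝒞_{1+q,k+1}`, `k + 1 ≤ N`**, for `q`
symmetric in the ball `Σ|q_{ij}| ≤ T₀ ≤ ½`, `K T₀ ≤ log(1+ρ)`, `ρ < θ̄` — the argument `hS` of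
`rgBQ` / `isRGStepQ_abkm_of_stepKernelBounds`. [cite: AdamsBuchholzKoteckyMuller2019, Lemma 7.7] -/
theorem stepKernelBounds_family_of_torusFRD
    (hd : 3 ≤ d) (hMord : 1 ≤ Mord) (hMR : Mord ≤ R) (hLodd : Odd L) (hL : 2 ^ (d + 3) + 16 * R ≤ L)
    (hθbar : 0 < θbar) (hlam : 0 < lam) (hn : 2 * Mord ≤ n) (hn2 : 2 ≤ n) (hnñ : n ≤ ñ)
    (hc : 0 < c) (hC1 : 0 ≤ Cℓ 1)
    (hallA : ∀ A : Matrix (Fin d) (Fin d) ℝ, IsElliptic (1 / 2 : ℝ) 2 A →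
        (∀ k, 1 ≤ k → k ≤ N + 1 →
          ∑ x : Fin d → ZMod M, 𝒞 A k x = 0 ∧ ∀ x, 𝒞 A k (-x) = 𝒞 A k x) ∧
        (∀ k, 1 ≤ k → k ≤ N + 1 → ∀ φ : (Fin d → ZMod M) → ℝ, ∑ x, φ x = 0 →
          0 ≤ ∑ x, ∑ y, φ x * 𝒞 A k (x - y) * φ y) ∧
        (∀ φ : (Fin d → ZMod M) → ℝ, ∑ x, φ x = 0 →
          ellOp A (conv (fun x => ∑ k ∈ Finset.Icc 1 (N + 1), 𝒞 A k x) φ) = φ) ∧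
        (∀ k, 1 ≤ k → k ≤ N → Mc k ≤ 0 ∧
          ∀ x : Fin d → ZMod M, ((L : ℝ) ^ k) / 2 ≤ (supNorm x : ℝ) →
            𝒞 A k x = Mc k) ∧
        (∀ k, 1 ≤ k → k ≤ N + 1 → ∀ B : Matrix (Fin d) (Fin d) ℝ, IsUnitSymm B →
          (∃ ε : ℝ, 0 < ε ∧ ∀ x : Fin d → ZMod M,
            ContDiffOn ℝ ⊤ (fun s : ℝ => 𝒞 (A + s • B) k x) (Set.Ioo (-ε) ε)) ∧
          ∀ α : Fin d → ℕ, ∑ i, α i ≤ n → ∀ ℓ : ℕ, ∀ x : Fin d → ZMod M,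
            abs (iteratedDeriv ℓ (fun s : ℝ => iterDiff α (𝒞 (A + s • B) k) x) 0)
              ≤ Cα α ℓ / (L : ℝ) ^ ((k - 1) * (d - 2 + ∑ i, α i))) ∧
        (∀ k, 1 ≤ k → k ≤ N + 1 → ∀ j : ℕ, ∀ κ : Fin d → ZMod M, κ ≠ 0 → InShell L j κ →
          (j < k →
            c / (L : ℝ) ^ (2 * (d + ñ) + 1) * (L : ℝ) ^ (2 * j)
                / (L : ℝ) ^ ((k - j) * (d - 1 + n)) ≤ (fourierCoeff (𝒞 A k) κ).re ∧
            ‖fourierCoeff (𝒞 A k) κ‖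
              ≤ C * (L : ℝ) ^ (2 * (d + ñ) + 1) * (L : ℝ) ^ (2 * j)
                  / (L : ℝ) ^ ((k - j) * (d - 1 + n))) ∧
          (k ≤ j →
            c / (L : ℝ) ^ (2 * (d + ñ) + 1) * (L : ℝ) ^ (2 * k)
                ≤ (fourierCoeff (𝒞 A k) κ).re ∧
            ‖fourierCoeff (𝒞 A k) κ‖ ≤ C * (L : ℝ) ^ (2 * k)) ∧
          ∀ B : Matrix (Fin d) (Fin d) ℝ, IsUnitSymm B → ∀ ℓ : ℕ, 1 ≤ ℓ →
            (j < k →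
              ‖iteratedDeriv ℓ (fun s : ℝ => fourierCoeff (𝒞 (A + s • B) k) κ) 0‖
                ≤ Cℓ ℓ * (L : ℝ) ^ (2 * (d + ñ) + 1) * (L : ℝ) ^ (2 * j)
                    / (L : ℝ) ^ ((k - j) * (d - 1 + ñ))) ∧
            (k ≤ j →
              ‖iteratedDeriv ℓ (fun s : ℝ => fourierCoeff (𝒞 (A + s • B) k) κ) 0‖
                ≤ Cℓ ℓ * (L : ℝ) ^ (2 * k))))
    (hB : AbkmWeightBounds L N Mord R n θbar lam μ δ₁ δ₀ A𝒫 (fun j => 𝒞 1 j)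
      (abkmWeightData L N Mord R θbar (schedDelta δ₀ δ₁ N) fun j => 𝒞 1 j))
    {ρ : ℝ} (hρ0 : 0 ≤ ρ) (hρ : ρ < θbar)
    {T₀ : ℝ} (hT₀ : T₀ ≤ 1 / 2) (hKT₀ : shellRatioConst c (Cℓ 1) (L : ℝ) d ñ * T₀ ≤ Real.log (1 + ρ))
    {q : Matrix (Fin d) (Fin d) ℝ} (hq : q.IsSymm) (hqT : ∑ i, ∑ j, |q i j| ≤ T₀) :
    ∀ k, k + 1 ≤ N →
      StepKernelBounds (abkmWeightData L N Mord R θbar (schedDelta δ₀ δ₁ N) fun j => 𝒞 1 j) L k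
        (weightIntConstRho θbar ρ (traceConst d Mord R lam (derivSum d n fun θ' _ => Cα θ' 0)))
        (secondDiffConst fun θ' => Cα θ' 0)
        ((fun j => 𝒞 ((1 : Matrix (Fin d) (Fin d) ℝ) + q) j) (k + 1)) :=
  fun _ hk => stepKernelBounds_one_add_of_torusFRD hd hMord hMR hLodd hL hθbar hlam hn hn2 hnñ hc hC1 hallA hB
    (by omega) hρ0 hρ hT₀ hKT₀ hq hqT

/-! ## `(12.52)`: `B_k` is Lipschitz in the tuning parameter, globally on the ball -/

set_option maxHeartbeats 400000 in
/-- **`(12.52)` at the level of the tuning parameter, globally on the ball** (module docstring):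
there is `b_T ≥ 0` with `‖rgBQ(𝒞s_{q'}) k v − rgBQ(𝒞s_q) k v‖ ≤ b_T · Σ|q'−q| · c` for all symmetric
`q, q'` in the `T₀`-ball, `k + 1 ≤ N`, and admissible activities `v` with `‖v‖_k ≤ c`.
[cite: AdamsBuchholzKoteckyMuller2019, Lemma 12.6 (12.52)] -/
theorem exists_norm_rgBQ_sub_le_of_torusFRD {h : ℝ} [Fact (0 < h)] [Fact (0 < L)]
    (hd : 3 ≤ d) (hMord : 1 ≤ Mord) (hMR : Mord ≤ R) (hLodd : Odd L) (hL : 2 ^ (d + 3) + 16 * R ≤ L)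
    (hM : M = L ^ N)
    (hθbar : 0 < θbar) (hlam : 0 < lam) (hn : 2 * Mord ≤ n) (hn2 : 2 ≤ n) (hnñ : n ≤ ñ)
    (hc : 0 < c) (hC1 : 0 ≤ Cℓ 1)
    (hallA : ∀ A : Matrix (Fin d) (Fin d) ℝ, IsElliptic (1 / 2 : ℝ) 2 A →
        (∀ k, 1 ≤ k → k ≤ N + 1 →
          ∑ x : Fin d → ZMod M, 𝒞 A k x = 0 ∧ ∀ x, 𝒞 A k (-x) = 𝒞 A k x) ∧
        (∀ k, 1 ≤ k → k ≤ N + 1 → ∀ φ : (Fin d → ZMod M) → ℝ, ∑ x, φ x = 0 →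
          0 ≤ ∑ x, ∑ y, φ x * 𝒞 A k (x - y) * φ y) ∧
        (∀ φ : (Fin d → ZMod M) → ℝ, ∑ x, φ x = 0 →
          ellOp A (conv (fun x => ∑ k ∈ Finset.Icc 1 (N + 1), 𝒞 A k x) φ) = φ) ∧
        (∀ k, 1 ≤ k → k ≤ N → Mc k ≤ 0 ∧
          ∀ x : Fin d → ZMod M, ((L : ℝ) ^ k) / 2 ≤ (supNorm x : ℝ) →
            𝒞 A k x = Mc k) ∧
        (∀ k, 1 ≤ k → k ≤ N + 1 → ∀ B : Matrix (Fin d) (Fin d) ℝ, IsUnitSymm B →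
          (∃ ε : ℝ, 0 < ε ∧ ∀ x : Fin d → ZMod M,
            ContDiffOn ℝ ⊤ (fun s : ℝ => 𝒞 (A + s • B) k x) (Set.Ioo (-ε) ε)) ∧
          ∀ α : Fin d → ℕ, ∑ i, α i ≤ n → ∀ ℓ : ℕ, ∀ x : Fin d → ZMod M,
            abs (iteratedDeriv ℓ (fun s : ℝ => iterDiff α (𝒞 (A + s • B) k) x) 0)
              ≤ Cα α ℓ / (L : ℝ) ^ ((k - 1) * (d - 2 + ∑ i, α i))) ∧
        (∀ k, 1 ≤ k → k ≤ N + 1 → ∀ j : ℕ, ∀ κ : Fin d → ZMod M, κ ≠ 0 → InShell L j κ →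
          (j < k →
            c / (L : ℝ) ^ (2 * (d + ñ) + 1) * (L : ℝ) ^ (2 * j)
                / (L : ℝ) ^ ((k - j) * (d - 1 + n)) ≤ (fourierCoeff (𝒞 A k) κ).re ∧
            ‖fourierCoeff (𝒞 A k) κ‖
              ≤ C * (L : ℝ) ^ (2 * (d + ñ) + 1) * (L : ℝ) ^ (2 * j)
                  / (L : ℝ) ^ ((k - j) * (d - 1 + n))) ∧
          (k ≤ j →
            c / (L : ℝ) ^ (2 * (d + ñ) + 1) * (L : ℝ) ^ (2 * k)
                ≤ (fourierCoeff (𝒞 A k) κ).re ∧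
            ‖fourierCoeff (𝒞 A k) κ‖ ≤ C * (L : ℝ) ^ (2 * k)) ∧
          ∀ B : Matrix (Fin d) (Fin d) ℝ, IsUnitSymm B → ∀ ℓ : ℕ, 1 ≤ ℓ →
            (j < k →
              ‖iteratedDeriv ℓ (fun s : ℝ => fourierCoeff (𝒞 (A + s • B) k) κ) 0‖
                ≤ Cℓ ℓ * (L : ℝ) ^ (2 * (d + ñ) + 1) * (L : ℝ) ^ (2 * j)
                    / (L : ℝ) ^ ((k - j) * (d - 1 + ñ))) ∧
            (k ≤ j →
              ‖iteratedDeriv ℓ (fun s : ℝ => fourierCoeff (𝒞 (A + s • B) k) κ) 0‖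
                ≤ Cℓ ℓ * (L : ℝ) ^ (2 * k))))
    (hB : AbkmWeightBounds L N Mord R n θbar lam μ δ₁ δ₀ A𝒫 (fun j => 𝒞 1 j)
      (abkmWeightData L N Mord R θbar (schedDelta δ₀ δ₁ N) fun j => 𝒞 1 j))
    {pT r₀ : ℕ} (hpM : pT + d ≤ Mord) (hr₀ : 3 ≤ r₀) {A : ℝ} (hA : 1 ≤ A)
    {ρ : ℝ} (hρ0 : 0 ≤ ρ) (hρ : ρ < θbar)
    {T₀ : ℝ} (hT₀ : T₀ ≤ 1 / 2) (hKT₀ : shellRatioConst c (Cℓ 1) (L : ℝ) d ñ * T₀ ≤ Real.log (1 + ρ)) :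
    ∃ bT : ℝ, 0 ≤ bT ∧
      ∀ (q q' : Matrix (Fin d) (Fin d) ℝ) (hq : q.IsSymm) (hq' : q'.IsSymm)
        (hqT : ∑ i, ∑ j, |q i j| ≤ T₀) (hq'T : ∑ i, ∑ j, |q' i j| ≤ T₀),
      ∀ k, k + 1 ≤ N →
      ∀ (v : activitySpace (abkmNormParams L N Mord R pT r₀ h θbar A (schedDelta δ₀ δ₁ N) fun j => 𝒞 1 j) k)
        (cv : ℝ),
        activityNormLE (abkmNormParams L N Mord R pT r₀ h θbar A (schedDelta δ₀ δ₁ N) fun j => 𝒞 1 j) k v cv →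
        ‖rgBQ (p := pT) (A := A) hB (by omega) hLodd hM
              (stepKernelBounds_family_of_torusFRD hd hMord hMR hLodd hL hθbar hlam hn hn2 hnñ hc hC1 hallA hB
                hρ0 hρ hT₀ hKT₀ hq' hq'T) k v -
            rgBQ (p := pT) (A := A) hB (by omega) hLodd hM
              (stepKernelBounds_family_of_torusFRD hd hMord hMR hLodd hL hθbar hlam hn hn2 hnñ hc hC1 hallA hB
                hρ0 hρ hT₀ hKT₀ hq hqT) k v‖ ≤
          bT * (∑ i, ∑ j, |(q' - q) i j|) * cv := by
  have hh : 0 < h := Fact.out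
  set P := abkmNormParams L N Mord R pT r₀ h θbar A (schedDelta δ₀ δ₁ N) fun j => 𝒞 1 j with hP
  have hA0 : 0 < A := by linarith
  have hPA : 0 < P.A := hA0
  have hL0 : (0 : ℝ) ≤ (L : ℝ) := Nat.cast_nonneg _
  -- constants
  set K := shellRatioConst c (Cℓ 1) (L : ℝ) d ñ with hKdef
  have hK0 : 0 ≤ K := shellRatioConst_nonneg hc hC1 hL0 d ñ
  set ρ'' := (ρ + θbar) / 2 with hρ''def
  have hρ''0 : 0 ≤ ρ'' := by rw [hρ''def]; linarith
  have hρ''θ : ρ'' < θbar := by rw [hρ''def]; linarith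
  have hρρ'' : ρ < ρ'' := by rw [hρ''def]; linarith
  set p := (1 + ρ'') / (1 + ρ) with hpdef
  have h1ρ : 0 < 1 + ρ := by linarith
  have hp1 : 1 < p := by rw [hpdef, one_lt_div h1ρ]; linarith
  have hp0 : 0 < p := by linarith
  set qH := Real.conjExponent p with hqHdef
  have hpq : p.HolderConjugate qH := Real.HolderConjugate.conjExponent hp1
  have hqH1 : 1 < qH := hpq.symm.lt
  have hqH0 : 0 < qH := by linarith
  have hpρ : p * (1 + ρ) ≤ 1 + ρ'' := by rw [hpdef, div_mul_cancel₀ _ h1ρ.ne']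
  set C87 := pi2BoundConst d (((2 * R + 2 : ℕ) : ℝ) + ((d / 2 + 1 : ℕ) : ℝ)) with hC87def
  have hC87 : 0 ≤ C87 := pi2BoundConst_nonneg d (by positivity)
  set gcc := gaussCompConst (Fintype.card (Fin d → ZMod M)) qH with hgccdef
  have hgcc : 0 ≤ gcc := gaussCompConst_nonneg _ hqH0.le
  set κp := weightIntConstRho θbar ρ'' (traceConst d Mord R lam (derivSum d n fun θ' _ => Cα θ' 0)) ^ (1 / p)
    with hκpdef
  have hA𝒫'' : 0 ≤ weightIntConstRho θbar ρ'' (traceConst d Mord R lam (derivSum d n fun θ' _ => Cα θ' 0)) :=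
    zero_le_one.trans (one_le_weightIntConstRho hθbar hρ''0 hρ''θ
      (traceConst_nonneg d Mord R hlam.le (derivSum_nonneg d n _)))
  have hκp : 0 ≤ κp := Real.rpow_nonneg hA𝒫'' _
  set A𝒫ρ := weightIntConstRho θbar ρ (traceConst d Mord R lam (derivSum d n fun θ' _ => Cα θ' 0)) with hA𝒫ρdef
  have hA𝒫ρ : 0 ≤ A𝒫ρ :=
    zero_le_one.trans (one_le_weightIntConstRho hθbar hρ0 hρ
      (traceConst_nonneg d Mord R hlam.le (derivSum_nonneg d n _)))
  -- the local range `T₁` and the two constants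
  set T₁ := min 1 (1 / (16 * qH * ((K + 1) * Real.exp (2 * K)))) with hT₁def
  have hden : 0 < 16 * qH * ((K + 1) * Real.exp (2 * K)) := by positivity
  have hT₁0 : 0 < T₁ := lt_min zero_lt_one (div_pos one_pos hden)
  have hT₁1 : T₁ ≤ 1 := min_le_left _ _
  set Λ₁ := (L : ℝ) ^ d * (C87 * ((r₀ + 1) * gcc * (K * Real.exp (2 * K)) * κp * A⁻¹)) with hΛ₁def
  have hΛ₁ : 0 ≤ Λ₁ := by positivity
  set B₁ := 2 * ((L : ℝ) ^ d * (C87 * (A𝒫ρ * A⁻¹))) with hB₁def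
  have hB₁ : 0 ≤ B₁ := by positivity
  refine ⟨max Λ₁ (B₁ / T₁), le_max_of_le_left hΛ₁, ?_⟩
  intro q q' hq hq' hqT hq'T k hk v cv hv
  have hkN1 : k + 1 ≤ N + 1 := by omega
  -- the step-kernel bounds of the two families
  have hSa := stepKernelBounds_family_of_torusFRD hd hMord hMR hLodd hL hθbar hlam hn hn2 hnñ hc hC1 hallA hB
    hρ0 hρ hT₀ hKT₀ hq' hq'T
  have hSb := stepKernelBounds_family_of_torusFRD hd hMord hMR hLodd hL hθbar hlam hn hn2 hnñ hc hC1 hallA hB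
    hρ0 hρ hT₀ hKT₀ hq hqT
  -- data of `v`
  have hvW : WeakNormLE P k (v : Finset (Fin d → ZMod M) → ((Fin d → ZMod M) → ℝ) → ℂ) cv := hv
  have hvd : ∀ X, ContDiff ℝ r₀ ((v : Finset (Fin d → ZMod M) → ((Fin d → ZMod M) → ℝ) → ℂ) X) :=
    activitySpace.contDiff v
  have hvloc : ∀ X, IsPolymer (L ^ k) X → IsConn X →
      IsGaugeLocal (P.gauge k X) ((v : Finset (Fin d → ZMod M) → ((Fin d → ZMod M) → ℝ) → ℂ) X) :=
    fun X hX hXc => activitySpace.isGaugeLocal v hX hXc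
  have hMt : M = P.L ^ k * L ^ (N - k) := by
    show M = L ^ k * L ^ (N - k)
    rw [hM, ← pow_add, Nat.add_sub_cancel' (by omega)]
  have hcv : 0 ≤ cv := nonneg_of_weakNormLE hPA hMt hLodd.pow hLodd.pow hvW
  -- rewrite the two `B`'s as `opB`
  set Da := abkmStepData L R k fun j => 𝒞 ((1 : Matrix (Fin d) (Fin d) ℝ) + q') j with hDa
  set Db := abkmStepData L R k fun j => 𝒞 ((1 : Matrix (Fin d) (Fin d) ℝ) + q) j with hDb
  have hnorm : ‖rgBQ (p := pT) (A := A) hB (by omega) hLodd hM hSa k v -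
        rgBQ (p := pT) (A := A) hB (by omega) hLodd hM hSb k v‖ =
      hamNorm (fieldWt h (L : ℝ) d (k + 1)) ((L : ℝ) ^ (k + 1)) (L ^ (d * (k + 1)))
        (opB Da (v : Finset (Fin d → ZMod M) → ((Fin d → ZMod M) → ℝ) → ℂ) -
          opB Db (v : Finset (Fin d → ZMod M) → ((Fin d → ZMod M) → ℝ) → ℂ)) := by
    rw [HamSpace.norm_def, map_sub]
    unfold rgBQ
    rw [dif_pos hk, dif_pos hk]
    show hamNorm _ _ _ (HamSpace.toHam (HamSpace.ofHam (opBHomQ (p := pT) (A := A) hB (by omega) hLodd hM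
        (abkmStepData L R k fun j => 𝒞 ((1 : Matrix (Fin d) (Fin d) ℝ) + q') j) (hSa k hk) (x₀ := 0) rfl v)) -
      HamSpace.toHam (HamSpace.ofHam (opBHomQ (p := pT) (A := A) hB (by omega) hLodd hM
        (abkmStepData L R k fun j => 𝒞 ((1 : Matrix (Fin d) (Fin d) ℝ) + q) j) (hSb k hk) (x₀ := 0) rfl v))) = _
    rw [HamSpace.toHam_ofHam, HamSpace.toHam_ofHam, opBHomQ_apply, opBHomQ_apply]
  rw [hnorm]
  set t := ∑ i, ∑ j, |(q' - q) i j| with htdef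
  have ht0 : 0 ≤ t := entrySum_nonneg _
  set D := hamNorm (fieldWt h (L : ℝ) d (k + 1)) ((L : ℝ) ^ (k + 1)) (L ^ (d * (k + 1)))
      (opB Da (v : Finset (Fin d → ZMod M) → ((Fin d → ZMod M) → ℝ) → ℂ) -
        opB Db (v : Finset (Fin d → ZMod M) → ((Fin d → ZMod M) → ℝ) → ℂ)) with hDdef
  -- far field: Lemma 10.6 twice
  have hfa : hamNorm (fieldWt h (L : ℝ) d (k + 1)) ((L : ℝ) ^ (k + 1)) (L ^ (d * (k + 1)))
        (opB Da (v : Finset (Fin d → ZMod M) → ((Fin d → ZMod M) → ℝ) → ℂ)) ≤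
      (L : ℝ) ^ d * (C87 * (cv * A𝒫ρ * A⁻¹)) :=
    hamNorm_opB_abkm_le_of_stepKernelBounds hd hLodd hL hM hk hpM hMR hr₀ hB hh hA Da (hSa k hk) rfl rfl hcv
      hvW hvd hvloc
  have hfb : hamNorm (fieldWt h (L : ℝ) d (k + 1)) ((L : ℝ) ^ (k + 1)) (L ^ (d * (k + 1)))
        (opB Db (v : Finset (Fin d → ZMod M) → ((Fin d → ZMod M) → ℝ) → ℂ)) ≤
      (L : ℝ) ^ d * (C87 * (cv * A𝒫ρ * A⁻¹)) :=
    hamNorm_opB_abkm_le_of_stepKernelBounds hd hLodd hL hM hk hpM hMR hr₀ hB hh hA Db (hSb k hk) rfl rfl hcv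
      hvW hvd hvloc
  have hfar : D ≤ B₁ * cv := by
    have htri : D ≤ hamNorm (fieldWt h (L : ℝ) d (k + 1)) ((L : ℝ) ^ (k + 1)) (L ^ (d * (k + 1)))
          (opB Da (v : Finset (Fin d → ZMod M) → ((Fin d → ZMod M) → ℝ) → ℂ)) +
        hamNorm (fieldWt h (L : ℝ) d (k + 1)) ((L : ℝ) ^ (k + 1)) (L ^ (d * (k + 1)))
          (opB Db (v : Finset (Fin d → ZMod M) → ((Fin d → ZMod M) → ℝ) → ℂ)) :=
      hamNorm_sub_le (fieldWt_pos hh (by exact_mod_cast hLodd.pos) d (k + 1)).le (by positivity) _ _ _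
    calc D ≤ (L : ℝ) ^ d * (C87 * (cv * A𝒫ρ * A⁻¹)) + (L : ℝ) ^ d * (C87 * (cv * A𝒫ρ * A⁻¹)) :=
          htri.trans (add_le_add hfa hfb)
      _ = B₁ * cv := by rw [hB₁def]; ring
  -- local: Lemma 8.4 (ℓ = 1) packaged, `τ = e^{Kt} − 1`
  have hloc : t ≤ T₁ → D ≤ Λ₁ * cv * t := by
    intro htT
    set τ := Real.exp (K * t) - 1 with hτdef
    have hτ0 : 0 ≤ τ := exp_mul_sub_one_nonneg hK0 ht0
    have hKT : K * t ≤ Real.log (1 + τ) := by rw [hτdef, log_one_add_exp_mul_sub_one]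
    have hτle : τ * (1 + τ) ≤ K * Real.exp (2 * K * T₁) * t := exp_mul_sub_one_mul_le hK0 ht0 htT
    have he1 : Real.exp (2 * K * T₁) ≤ Real.exp (2 * K) := by
      apply Real.exp_le_exp.2
      calc 2 * K * T₁ ≤ 2 * K * 1 := mul_le_mul_of_nonneg_left hT₁1 (by positivity)
        _ = 2 * K := mul_one _
    have hτle' : τ * (1 + τ) ≤ K * Real.exp (2 * K) * t :=
      hτle.trans (mul_le_mul_of_nonneg_right (mul_le_mul_of_nonneg_left he1 hK0) ht0)
    have hτq : τ * (1 + τ) ≤ 1 / (16 * qH) := by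
      have h2 : K * Real.exp (2 * K) * t ≤ K * Real.exp (2 * K) * T₁ :=
        mul_le_mul_of_nonneg_left htT (by positivity)
      have h3 : K * Real.exp (2 * K) * T₁ ≤
          K * Real.exp (2 * K) * (1 / (16 * qH * ((K + 1) * Real.exp (2 * K)))) :=
        mul_le_mul_of_nonneg_left (min_le_right _ _) (by positivity)
      have h4 : K * Real.exp (2 * K) * (1 / (16 * qH * ((K + 1) * Real.exp (2 * K)))) ≤ 1 / (16 * qH) := by
        rw [mul_one_div, div_le_div_iff₀ hden (by positivity), one_mul]
        have : K * Real.exp (2 * K) * (16 * qH) ≤ (K + 1) * Real.exp (2 * K) * (16 * qH) := by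
          gcongr; linarith
        linarith
      linarith
    have hmain := hamNorm_opB_sub_of_torusFRD hd hMord hMR hLodd hL hM hθbar hlam hn hn2 hnñ hc hC1 hallA hB hk
      hpM hr₀ hh hA hρ0 hρ hT₀ hKT₀ hq hq' hqT hq'T hpq hρ''0 hρ''θ hpρ hτ0 hKT hτq hcv hvW hvd hvloc
    refine hmain.trans ?_
    have hstep : cv * ((r₀ + 1) * gcc * (τ * (1 + τ))) * κp * A⁻¹ ≤
        cv * ((r₀ + 1) * gcc * (K * Real.exp (2 * K) * t)) * κp * A⁻¹ := by
      have hr1 : (0 : ℝ) ≤ (r₀ : ℝ) + 1 := by positivity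
      gcongr
    calc (L : ℝ) ^ d * (C87 * (cv * ((r₀ + 1) * gcc * (τ * (1 + τ))) * κp * A⁻¹))
        ≤ (L : ℝ) ^ d * (C87 * (cv * ((r₀ + 1) * gcc * (K * Real.exp (2 * K) * t)) * κp * A⁻¹)) :=
          mul_le_mul_of_nonneg_left (mul_le_mul_of_nonneg_left hstep hC87) (by positivity)
      _ = Λ₁ * cv * t := by rw [hΛ₁def]; ring
  -- local → global
  have hglob := le_max_mul_of_local_lipschitz (D := D) (Λ := Λ₁ * cv) (B := B₁ * cv) hT₁0
    (mul_nonneg hB₁ hcv) ht0 hloc hfar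
  refine hglob.trans (le_of_eq ?_)
  rw [show B₁ * cv / T₁ = B₁ / T₁ * cv by ring, ← max_mul_of_nonneg _ _ hcv]
  ring

end Package

end Literature.MathematicalPhysics.StatisticalMechanics.GradientRG

end
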